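import Summits.QuantumFields.BalabanUV.Beta.SymCorrectorFaceDiv
import Summits.QuantumFields.BalabanUV.Beta.SymCorrectorFaceWeight
import Summits.QuantumFields.BalabanUV.Beta.WardLocusCombSecondOrder
import Summits.QuantumFields.BalabanUV.Beta.SpineRecursiveParity

/-!
# `BalabanUV.Beta.GAN24.CombSlotTransportFaceWard` — binder row G-an2-4 ∕ (CONV-C), TRANSFER-III (the G-an2-4 END at row D1's literal of record (III′)), THE OWNER gan24-p1
# g46's QUESTION (Q2) of NOTE N-gan24p1-g46-1 (journal l.65047): «is the face part of the slot transport, `slotPsiS T − T = (α x ↦ faceWt r n α x • faceSum n T (blk n x))`,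
# NULL or CONTRACTING on the even tower's class?» — ANSWERED BY NAME, AT THE LEVEL OF IDENTITIES: **THE FACE SUM IS THE BLOCK WARD CHARGE, SO ON THE (III′) TOWER THE FACE
# PART OF THE SLOT TRANSPORT IS THE TOWER's OWN WARD WORD — the EXACT contact commutator `conjV (bhKStepSh j) (X Y)` (scaled) for the first-order tables `ScombOf ∕ SpureCombOf`,
# `commutator + residual` for the second-order carrier `WcombOf` (commutator alone on its even half); NOT ZERO; and it is blind to the zero-mode class (`zmode`∕`ZfreeSym` is the
# block SUM of a table, the face sum is its block DIVERGENCE)**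
# (G-an2-4 CRUX TEAM (2), seat `b2b-balaban-gan24-p2` = road-P2 chair, gen 55 — «first refusal leaf-06 (face reads) ∕ road-P2 (value ledger) ∕ leaf-03» per the NOTE; road-P2 takes it)

NOT IN PRINT; OUR BOOKKEEPING ([folklore] finite-sum bookkeeping BY NAME over d1-formalise-leaf-03 gen 29's `SymCorrectorFaceDiv.faceSum_eq_blockSum_divV ∕ slotPsiS` (TT7: «the face sum is
the block sum of the divergence vertices»), `SymCorrectorFaceWeight.sum_blockSitesF_eq_sum_box`, an2 gen 35∕36's (III′) Ward laws `WardLocusCombShift.hSd_SrecOf_GcombSh_bhKStepSh_all_pins` ∕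
`WardLocusCombSockets.hSd_SpureCombOf_all` ((Sd), first order) and `WardLocusCombSecondOrder.exists_kernelLaws_WcombOf_of_letters` ((Wd), second order), leaf-05's
`SpineRecursiveParity` parity algebra; 0 `def`, 0 cited fact, 0 `def … : Prop`, 0 sorry).
HONEST FRAMING (cell contract, verbatim): «discharging `BetaPertH` makes Bałaban's UV stability UNCONDITIONAL — a real constructive-QFT result; it is NOT the continuum
limit and NOT the Clay problem.»  HONEST DEPENDENCY (verbatim): «continuum YM on T⁴ ⇐ BetaPertH ∧ nine spine estimates (0/9 proved); BetaPertH ⇐ (D1) ∧ (D4) ∧ CAP+tail;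
G-an2-4 gates asym, D1 and NE2/3/4.»
ABSOLUTE RULE (cell charter, verbatim): «No internally-minted statement may enter as a cited fact. Every hypothesis is either kernel-proved in this package or a
verbatim quotation of a PUBLISHED theorem with page reference. The manuscript(s) under audit are NOT citable for their own disputed steps — they are the thing under
adjudication; programme-internal (2001/route/tribunal) claims are never citable.»  Nothing is cited here.

## Why (context only; asserted nowhere below)
Road-P2's `CombCubicStepTransport` (M.43, this gen) and d1-leaf-03's `SymCorrectorRest ∕ SymCorrectorLiteralW` (the W-side words) show that the (III′) jet tower runs the (E) level
maps on tables transported by `𝒯 = Ψ̂_Sᵀ ∘ slotPsiS(·) ∘ Ψ̂_S`, with `slotPsiS T = T + T^face`, `T^face α x = faceWt r n α x • faceSum n T (blk n x)`.  The OWNER's NOTE (Q2) asks whether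
the face part is null or contracting «on the even tower's class», proposing to probe `faceSum n (½•(X + P X)) (blk n x)` against road-P2's `zmode`.  THE ANSWER IS AN IDENTITY, NOT AN
ESTIMATE: by TT7 `faceSum n T Y = Σ_{x ∈ B(Y)} divV T x` — the block total of the PURE-GAUGE (divergence) vertices — i.e. EXACTLY the left-hand side of the tower's block Ward laws;
so the face parts are the Ward WORDS of the tower, which an2's (III′) chain already types: (Sd) for the first-order tables (an exact contact commutator with the shifted bordered
Hessian `bhKStepSh j` and the block gauge generator `X Y = diagK (½•Σ_v legInd ρ_c (Lc•Y+v))`), (Wd) for the carrier (commutator `conjV (dM G′_j S′_j M_j) (X Y)` plus a parity-odd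
residual `Nr`).  They are NOT zero (the commutator words are the tower's contact terms), they are parity-graded exactly as the (α-0) chain grades them (even half = commutator,
odd half = residual — `faceSum` commutes with `P = sgnK∘trK`), and they are INVISIBLE to the zero-mode class: `zmode`∕`ZfreeSym` constrain the block SUM `Σ_{u ∈ B} T κ u`,
the face sum is the block DIVERGENCE `Σ_{x ∈ B} Σ_κ (T κ (x−e_κ) − T κ x)` — a boundary flux, unconstrained by (C).  So, in the NOTE's dichotomy: NOT «null»; «one of the chain's
already-typed words» — the Ward contact words; whether the (E) value ledger (L10) PRICES them at `GcombSh` is leaf-06's (γ) hand, not decided here.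

## What is proved (generic `d`, blocking `n` with `0 < n`, root offset `r`)
* §1 `faceSum_eq_sum_box_divV` (kernel families, box-indexed: `faceSum n S Y = Σ_{v ∈ box} divV S (n•Y + v)`); **`faceSum_of_blockWardLaw`** ∕ **`slotPsiS_of_blockWardLaw`**: a
  BLOCK-SUMMED law `c • Σ_{v ∈ box} divV S (n•Y+v) = C Y` (`c ≠ 0`) prices the face sum as `c⁻¹ • C Y` and the face family as `(faceWt α x · c⁻¹) • C (blk n x)`;
  `faceSum_firstSlot_eq_sum_box_divW` (a coarse-slot carrier `W μ y ν y′`: the face sum in its first slot is the block sum of an2's `divW W · ν y′`);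
  `faceSum_add' ∕ _sub' ∕ _smul'`, `faceSum_sgnK_trK` (the face sum commutes with the parity involution slice by slice), hence `faceSum_evenHalf ∕ faceSum_oddHalf`.
* §2 THE (III′) FIRST-ORDER TABLES (`[NeZero Lc]`, `ρ_c`, pins of record `(cE, cVH) = (Lc^{d+1}, −Lc^{d+1}·½·Lc^{d+1})`, under an2's border letter (V-d)):
  **`faceSum_ScombOf_eq_conjV`** ∕ `faceSum_SpureCombOf_eq_conjV`: `faceSum Lc (ScombOf tabs … j) Y = (stepScale d Lc j · Lc^{d+1}) • conjV (bhKStepSh d Lc (Dsh Lc) j) (X Y)`;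
  **`slotPsiS_ScombOf_eq`** ∕ `slotPsiS_SpureCombOf_eq`: `slotPsiS r Lc (ScombOf tabs … j) α x = ScombOf tabs … j α x + (faceWt r Lc α x · stepScale d Lc j · Lc^{d+1}) • conjV (bhKStepSh d Lc (Dsh Lc) j) (X (blk Lc x))`
  — THE FACE PART OF THE (III′) SLOT TRANSPORT ON THE S-TOWER IS THE EXACT FIRST-ORDER WARD CONTACT WORD.
* §3 THE (III′) CARRIER (package form, as in road-P2's `CombWardLawParitySplit` §2): **`faceSum_firstSlot_WcombOf_of_package`**: under ANY residual package of an2's shape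
  (`divW (WcombOf … j) y ν y′ = conjV (dM G′_j S′_j (tabs.M j) ν y′) (X y) + Nr j y ν y′`): `faceSum n (μ y ↦ WcombOf … j μ y ν y′) Y = Σ_{v ∈ box} (conjV (…) (X (n•Y+v)) + Nr j (n•Y+v) ν y′)`,
  for EVERY blocking `n` (the carrier's slots are coarse bonds; the identity is blocking-generic); the letters version is one `obtain` over an2's
  `exists_kernelLaws_WcombOf_of_letters` at the consumer (not restated here — one home per statement: road-P2's `CombWardLawParitySplit` §2 carries that binder list).
WHAT THIS IS NOT: no estimate («contracting» is not decided — the words are exact, their SIZE through the tower is the campaign); nothing about the running fine bi-table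
`T2RecOf … j`'s slot laws at levels `j ≥ 1` (an2's chain carries them internally — `WardLocusRecursiveStepSlot` — and exports only the carrier's law: a located gap if the W-campaign
wants the face parts of `slotPsiS∘slotPsiS (T2RecOf … j)` in closed form); NO value, NO rate; NO campaign opened (an2 W-4 l.64553 stands); NEVER «G-an2-4 closed» as (CONV-C);
NOT D1, NOT `BetaPertH`, NOT continuum, NOT Clay.  2026-08-25; no existing file touched.
-/

noncomputable section

open Finset
open scoped BigOperators
open Literature.MathematicalPhysics.QuantumFieldTheory
open Literature.MathematicalPhysics.QuantumFieldTheory.Balaban1983to89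
open Literature.MathematicalPhysics.QuantumFieldTheory.Balaban1983to89.Beta
open ExpKernelCalculus (MKer VertexFamily)
open KernelWard (divV divW)
open AffineAveraging (Site box toSite)
open AveragingContours (blk)
open AveragingContoursRooted (ctr ctrOff ctrOff_mem_box)
open OneStepResolventKernel (Fib LocStencil)
open SecondOrderResponse (dM)
open Summit.QuantumFields.BalabanUV.Beta.TameKernelCalculus (trK trK_add trK_sub)
open Summit.QuantumFields.BalabanUV.Beta.BorderedHessian (bhK stepScale diagK sgnK stepScale_pos)
open Summit.QuantumFields.BalabanUV.Beta.ChartConjugation (conjV)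
open Summit.QuantumFields.BalabanUV.Beta.AveragingWardRootedStencils (legInd)
open Summit.QuantumFields.BalabanUV.Beta.WardLocusStencils (ffK)
open Summit.QuantumFields.BalabanUV.Beta.DshAn1 (Dsh)
open Summit.QuantumFields.BalabanUV.Beta.SymShiftedSpread (bhKStepSh)
open Summit.QuantumFields.BalabanUV.Beta.SymmetrisedStepJets (SymTables)
open Summit.QuantumFields.BalabanUV.Beta.CombChartStepJets (GcombSh ScombOf SpureCombOf ScombOf_eq WcombOf)
open Summit.QuantumFields.BalabanUV.Beta.WardLocusCombShift (hSd_SrecOf_GcombSh_bhKStepSh_all_pins)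
open Summit.QuantumFields.BalabanUV.Beta.WardLocusCombSockets (hSd_SpureCombOf_all)
open Summit.QuantumFields.BalabanUV.Beta.CompositeCorrectorLocality (blockSitesF)
open Summit.QuantumFields.BalabanUV.Beta.SymCorrectorFace (faceWt faceSum slotPsiS slotPsiS_apply faceSum_apply_kernel)
open Summit.QuantumFields.BalabanUV.Beta.SymCorrectorFaceDiv (faceSum_eq_blockSum_divV)
open Summit.QuantumFields.BalabanUV.Beta.SymCorrectorFaceWeight (sum_blockSitesF_eq_sum_box)
open Summit.QuantumFields.BalabanUV.Beta.KernelWardRemainderParity (sgnK_add)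
open Summit.QuantumFields.BalabanUV.Beta.SpineRecursiveParity (sgnK_smul trK_smul)

namespace Summit.QuantumFields.BalabanUV.Beta.GAN24.CombSlotTransportFaceWard

variable {d : ℕ}

/-! ## §1 The face sum is the block Ward charge -/

section Generic

variable {n : ℕ} (hn : 0 < n)
include hn

/-- [folklore] **THE FACE SUM, BOX-INDEXED**: `faceSum n S Y = Σ_{v ∈ box (d+1) n} divV S (n•Y + v)` — TT7's block sum of divergence vertices re-indexed by the box
(`sum_blockSitesF_eq_sum_box`, entrywise) — literally the left-hand side of the tower's block Ward laws. -/
theorem faceSum_eq_sum_box_divV (S : Fin (d + 1) → Site (d + 1) → MKer (d + 1) (Fib d)) (Y : Site (d + 1)) :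
    faceSum n S Y = ∑ v ∈ box (d + 1) n, divV S ((n : ℤ) • Y + toSite v) := by
  rw [faceSum_eq_blockSum_divV hn]
  funext p q a b
  simp only [Finset.sum_apply]
  exact sum_blockSitesF_eq_sum_box hn (fun x => divV S x p q a b) Y

/-- NOT IN PRINT; OUR BOOKKEEPING ([folklore]).  **A BLOCK-SUMMED WARD LAW PRICES THE FACE SUM**: if `c • Σ_{v ∈ box} divV S (n•Y + v) = C Y` for every block `Y` with `c ≠ 0`,
then `faceSum n S Y = c⁻¹ • C Y` — the face sum IS the (rescaled) Ward word. -/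
theorem faceSum_of_blockWardLaw {S : Fin (d + 1) → Site (d + 1) → MKer (d + 1) (Fib d)} {c : ℝ} (hc : c ≠ 0) {C : Site (d + 1) → MKer (d + 1) (Fib d)}
    (hlaw : ∀ Y : Site (d + 1), c • ∑ v ∈ box (d + 1) n, divV S ((n : ℤ) • Y + toSite v) = C Y) (Y : Site (d + 1)) :
    faceSum n S Y = c⁻¹ • C Y := by
  rw [faceSum_eq_sum_box_divV hn, ← hlaw Y, smul_smul, inv_mul_cancel₀ hc, one_smul]

/-- NOT IN PRINT; OUR BOOKKEEPING ([folklore]).  **… AND THE FACE FAMILY OF THE SLOT TRANSPORT**: under the same law,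
`slotPsiS r n S α x = S α x + (faceWt r n α x · c⁻¹) • C (blk n x)` — the slot-transported table is the table PLUS its slot's face weight times the Ward word of its block. -/
theorem slotPsiS_of_blockWardLaw (r : Fin (d + 1) → ℕ) {S : Fin (d + 1) → Site (d + 1) → MKer (d + 1) (Fib d)} {c : ℝ} (hc : c ≠ 0)
    {C : Site (d + 1) → MKer (d + 1) (Fib d)} (hlaw : ∀ Y : Site (d + 1), c • ∑ v ∈ box (d + 1) n, divV S ((n : ℤ) • Y + toSite v) = C Y)
    (α : Fin (d + 1)) (x : Site (d + 1)) :
    slotPsiS r n S α x = S α x + (faceWt r n α x * c⁻¹) • C (blk n x) := by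
  show S α x + faceWt r n α x • faceSum n S (blk n x) = _
  rw [faceSum_of_blockWardLaw hn hc hlaw, smul_smul]

/-- [folklore] **A COARSE-SLOT CARRIER: the face sum in the first bond slot is the block sum of an2's `divW`** — for `W μ y ν y′` and a fixed second slot `(ν, y′)`,
`faceSum n (μ y ↦ W μ y ν y′) Y = Σ_{v ∈ box} divW W (n•Y + v) ν y′` (`divW W y ν y′ = divV (μ y ↦ W μ y ν y′) y` by `rfl`). -/
theorem faceSum_firstSlot_eq_sum_box_divW (W : Fin (d + 1) → Site (d + 1) → Fin (d + 1) → Site (d + 1) → MKer (d + 1) (Fib d))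
    (ν : Fin (d + 1)) (y' : Site (d + 1)) (Y : Site (d + 1)) :
    faceSum n (fun μ y => W μ y ν y') Y = ∑ v ∈ box (d + 1) n, divW W ((n : ℤ) • Y + toSite v) ν y' :=
  faceSum_eq_sum_box_divV hn (fun μ y => W μ y ν y') Y

omit hn in
/-- [folklore] **THE FACE SUM COMMUTES WITH THE PARITY INVOLUTION** `P = sgnK ∘ trK` applied slot-entry-wise (a finite real-linear combination of the entries). -/
theorem faceSum_sgnK_trK (S : Fin (d + 1) → Site (d + 1) → MKer (d + 1) (Fib d)) (Y : Site (d + 1)) :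
    faceSum n (fun κ u => sgnK (trK (S κ u))) Y = sgnK (trK (faceSum n S Y)) := by
  funext p q a b
  rw [faceSum_apply_kernel, BorderedHessian.sgnK_apply, TameKernelCalculus.trK_apply, faceSum_apply_kernel]
  simp only [faceSum, BorderedHessian.sgnK_apply, TameKernelCalculus.trK_apply, smul_eq_mul, Finset.mul_sum]
  refine Finset.sum_congr rfl fun κ _ => Finset.sum_congr rfl fun u _ => ?_
  ring

omit hn in
/-- [folklore] The face sum is additive in the table. -/
theorem faceSum_add' (A B : Fin (d + 1) → Site (d + 1) → MKer (d + 1) (Fib d)) (Y : Site (d + 1)) :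
    faceSum n (fun κ u => A κ u + B κ u) Y = faceSum n A Y + faceSum n B Y := by
  simp only [faceSum, smul_add, Finset.sum_add_distrib]

omit hn in
/-- [folklore] The face sum is subtractive in the table. -/
theorem faceSum_sub' (A B : Fin (d + 1) → Site (d + 1) → MKer (d + 1) (Fib d)) (Y : Site (d + 1)) :
    faceSum n (fun κ u => A κ u - B κ u) Y = faceSum n A Y - faceSum n B Y := by
  simp only [faceSum, smul_sub, Finset.sum_sub_distrib]

omit hn in
/-- [folklore] The face sum is homogeneous in the table. -/
theorem faceSum_smul' (c : ℝ) (A : Fin (d + 1) → Site (d + 1) → MKer (d + 1) (Fib d)) (Y : Site (d + 1)) :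
    faceSum n (fun κ u => c • A κ u) Y = c • faceSum n A Y := by
  rw [faceSum, faceSum, Finset.smul_sum]
  refine Finset.sum_congr rfl fun κ _ => ?_
  rw [Finset.smul_sum]
  refine Finset.sum_congr rfl fun u _ => ?_
  rw [smul_comm]

omit hn in
/-- [folklore] **THE FACE SUM OF THE EVEN HALF IS THE EVEN HALF OF THE FACE SUM** (`½•(S + P S)` slot-entry-wise) — so on an even table the face part of the slot transport is
the even part of its Ward word (the commutator, by road-P2's L3 `CombWardLawParitySplit`). -/
theorem faceSum_evenHalf (S : Fin (d + 1) → Site (d + 1) → MKer (d + 1) (Fib d)) (Y : Site (d + 1)) :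
    faceSum n (fun κ u => (1 / 2 : ℝ) • (S κ u + sgnK (trK (S κ u)))) Y = (1 / 2 : ℝ) • (faceSum n S Y + sgnK (trK (faceSum n S Y))) := by
  rw [← faceSum_sgnK_trK]
  show faceSum n (fun κ u => (1 / 2 : ℝ) • ((fun κ u => S κ u + (fun κ u => sgnK (trK (S κ u))) κ u) κ u)) Y = _
  rw [faceSum_smul', faceSum_add']

omit hn in
/-- [folklore] **THE FACE SUM OF THE ODD HALF IS THE ODD HALF OF THE FACE SUM** (`½•(S − P S)` slot-entry-wise) — on an odd table the face part is the residual. -/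
theorem faceSum_oddHalf (S : Fin (d + 1) → Site (d + 1) → MKer (d + 1) (Fib d)) (Y : Site (d + 1)) :
    faceSum n (fun κ u => (1 / 2 : ℝ) • (S κ u - sgnK (trK (S κ u)))) Y = (1 / 2 : ℝ) • (faceSum n S Y - sgnK (trK (faceSum n S Y))) := by
  rw [← faceSum_sgnK_trK]
  show faceSum n (fun κ u => (1 / 2 : ℝ) • ((fun κ u => S κ u - (fun κ u => sgnK (trK (S κ u))) κ u) κ u)) Y = _
  rw [faceSum_smul', faceSum_sub']

end Generic

/-! ## §2 The (III′) first-order tables: the face part of the slot transport is the exact Ward contact word -/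

section FirstOrder

variable {Lc : ℕ} [NeZero Lc]

/-- NOT IN PRINT; OUR BOOKKEEPING ([folklore]; (Q2) AT FIRST ORDER, THE FOLDED TABLES).  **THE FACE SUM OF THE (III′) S-TOWER MEMBER IS THE EXACT WARD CONTACT WORD**:
for ANY sym record `tabs`, under an2's border letter (V-d), at the pins of record, every level `j` and every block `Y`:
`faceSum Lc (ScombOf tabs … j) Y = (stepScale d Lc j · Lc^{d+1}) • conjV (bhKStepSh d Lc (Dsh Lc) j) (diagK (½ • Σ_v legInd ρ_c (Lc•Y+v)))`
(an2's (Sd) law `hSd_SrecOf_GcombSh_bhKStepSh_all_pins` ⨾ §1).  NOT zero: it is the tower's first-order contact commutator with the block gauge generator. -/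
theorem faceSum_ScombOf_eq_conjV (tabs : SymTables d Lc)
    (hVd : ∀ u : Fin (d + 1) → ℤ, conjV (bhK Lc + Dsh Lc) (diagK (legInd (ctr (d + 1) Lc) u)) =
      conjV (ffK (bhK (d := d) Lc)) (diagK (legInd (ctr (d + 1) Lc) u)) - ((Lc : ℝ) ^ (d + 1)) • divV tabs.V u)
    (cΛ : ℝ) (j : ℕ) (Y : Site (d + 1)) :
    faceSum Lc (ScombOf tabs ((Lc : ℝ) ^ (d + 1)) (-((Lc : ℝ) ^ (d + 1) * (1 / 2) * (Lc : ℝ) ^ (d + 1))) cΛ j) Y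
      = (stepScale d Lc j * (Lc : ℝ) ^ (d + 1)) •
          conjV (bhKStepSh d Lc (Dsh Lc) j) (diagK ((1 / 2 : ℝ) • ∑ v ∈ box (d + 1) Lc, legInd (ctr (d + 1) Lc) ((Lc : ℤ) • Y + toSite v))) := by
  have hLc : 0 < Lc := Nat.pos_of_ne_zero (NeZero.ne Lc)
  have hc : (stepScale d Lc j * (Lc : ℝ) ^ (d + 1))⁻¹ ≠ 0 := by
    have h1 : 0 < stepScale d Lc j := stepScale_pos j
    have h2 : (0 : ℝ) < (Lc : ℝ) ^ (d + 1) := by positivity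
    exact inv_ne_zero (mul_pos h1 h2).ne'
  rw [ScombOf_eq, faceSum_of_blockWardLaw hLc hc (fun Y => hSd_SrecOf_GcombSh_bhKStepSh_all_pins (Lc := Lc) tabs.hV tabs.hH hVd cΛ j Y), inv_inv]

/-- NOT IN PRINT; OUR BOOKKEEPING ([folklore]; (Q2) AT FIRST ORDER, THE PURE TABLES).  The same for the pure (Λ-free) tables `SpureCombOf tabs … j` read by the W-words
(an2's `hSd_SpureCombOf_all` ⨾ §1). -/
theorem faceSum_SpureCombOf_eq_conjV (tabs : SymTables d Lc)
    (hVd : ∀ u : Fin (d + 1) → ℤ, conjV (bhK Lc + Dsh Lc) (diagK (legInd (ctr (d + 1) Lc) u)) =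
      conjV (ffK (bhK (d := d) Lc)) (diagK (legInd (ctr (d + 1) Lc) u)) - ((Lc : ℝ) ^ (d + 1)) • divV tabs.V u)
    (cΛ : ℝ) (j : ℕ) (Y : Site (d + 1)) :
    faceSum Lc (SpureCombOf tabs ((Lc : ℝ) ^ (d + 1)) (-((Lc : ℝ) ^ (d + 1) * (1 / 2) * (Lc : ℝ) ^ (d + 1))) cΛ j) Y
      = (stepScale d Lc j * (Lc : ℝ) ^ (d + 1)) •
          conjV (bhKStepSh d Lc (Dsh Lc) j) (diagK ((1 / 2 : ℝ) • ∑ v ∈ box (d + 1) Lc, legInd (ctr (d + 1) Lc) ((Lc : ℤ) • Y + toSite v))) := by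
  have hLc : 0 < Lc := Nat.pos_of_ne_zero (NeZero.ne Lc)
  have hc : (stepScale d Lc j * (Lc : ℝ) ^ (d + 1))⁻¹ ≠ 0 := by
    have h1 : 0 < stepScale d Lc j := stepScale_pos j
    have h2 : (0 : ℝ) < (Lc : ℝ) ^ (d + 1) := by positivity
    exact inv_ne_zero (mul_pos h1 h2).ne'
  rw [faceSum_of_blockWardLaw hLc hc (fun Y => hSd_SpureCombOf_all tabs hVd cΛ j Y), inv_inv]

/-- NOT IN PRINT; OUR BOOKKEEPING ([folklore]; (Q2) AT FIRST ORDER — THE SLOT TRANSPORT ITSELF).  **THE (III′) SLOT TRANSPORT OF THE S-TOWER MEMBER IS THE MEMBER PLUS ITS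
SLOT's FACE WEIGHT TIMES THE EXACT WARD CONTACT WORD OF ITS BLOCK** (any root offset `r`; the chart of record has `r = ctrOff (d+1) Lc`):
`slotPsiS r Lc (ScombOf tabs … j) α x = ScombOf tabs … j α x + (faceWt r Lc α x · stepScale d Lc j · Lc^{d+1}) • conjV (bhKStepSh d Lc (Dsh Lc) j) (diagK (½ • Σ_v legInd ρ_c (Lc•blk x+v)))`. -/
theorem slotPsiS_ScombOf_eq (r : Fin (d + 1) → ℕ) (tabs : SymTables d Lc)
    (hVd : ∀ u : Fin (d + 1) → ℤ, conjV (bhK Lc + Dsh Lc) (diagK (legInd (ctr (d + 1) Lc) u)) =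
      conjV (ffK (bhK (d := d) Lc)) (diagK (legInd (ctr (d + 1) Lc) u)) - ((Lc : ℝ) ^ (d + 1)) • divV tabs.V u)
    (cΛ : ℝ) (j : ℕ) (α : Fin (d + 1)) (x : Site (d + 1)) :
    slotPsiS r Lc (ScombOf tabs ((Lc : ℝ) ^ (d + 1)) (-((Lc : ℝ) ^ (d + 1) * (1 / 2) * (Lc : ℝ) ^ (d + 1))) cΛ j) α x
      = ScombOf tabs ((Lc : ℝ) ^ (d + 1)) (-((Lc : ℝ) ^ (d + 1) * (1 / 2) * (Lc : ℝ) ^ (d + 1))) cΛ j α x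
        + (faceWt r Lc α x * (stepScale d Lc j * (Lc : ℝ) ^ (d + 1))) •
            conjV (bhKStepSh d Lc (Dsh Lc) j) (diagK ((1 / 2 : ℝ) • ∑ v ∈ box (d + 1) Lc, legInd (ctr (d + 1) Lc) ((Lc : ℤ) • blk Lc x + toSite v))) := by
  show _ + faceWt r Lc α x • faceSum Lc _ (blk Lc x) = _
  rw [faceSum_ScombOf_eq_conjV tabs hVd cΛ j (blk Lc x), smul_smul]

/-- NOT IN PRINT; OUR BOOKKEEPING ([folklore]).  The same for the pure tables `SpureCombOf tabs … j`. -/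
theorem slotPsiS_SpureCombOf_eq (r : Fin (d + 1) → ℕ) (tabs : SymTables d Lc)
    (hVd : ∀ u : Fin (d + 1) → ℤ, conjV (bhK Lc + Dsh Lc) (diagK (legInd (ctr (d + 1) Lc) u)) =
      conjV (ffK (bhK (d := d) Lc)) (diagK (legInd (ctr (d + 1) Lc) u)) - ((Lc : ℝ) ^ (d + 1)) • divV tabs.V u)
    (cΛ : ℝ) (j : ℕ) (α : Fin (d + 1)) (x : Site (d + 1)) :
    slotPsiS r Lc (SpureCombOf tabs ((Lc : ℝ) ^ (d + 1)) (-((Lc : ℝ) ^ (d + 1) * (1 / 2) * (Lc : ℝ) ^ (d + 1))) cΛ j) α x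
      = SpureCombOf tabs ((Lc : ℝ) ^ (d + 1)) (-((Lc : ℝ) ^ (d + 1) * (1 / 2) * (Lc : ℝ) ^ (d + 1))) cΛ j α x
        + (faceWt r Lc α x * (stepScale d Lc j * (Lc : ℝ) ^ (d + 1))) •
            conjV (bhKStepSh d Lc (Dsh Lc) j) (diagK ((1 / 2 : ℝ) • ∑ v ∈ box (d + 1) Lc, legInd (ctr (d + 1) Lc) ((Lc : ℤ) • blk Lc x + toSite v))) := by
  show _ + faceWt r Lc α x • faceSum Lc _ (blk Lc x) = _
  rw [faceSum_SpureCombOf_eq_conjV tabs hVd cΛ j (blk Lc x), smul_smul]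

end FirstOrder

/-! ## §3 The (III′) carrier: the face sum in its bond slot is the block sum of the second-order Ward word -/

section Carrier

variable {Lc : ℕ} [NeZero Lc] {n : ℕ} (hn : 0 < n)
include hn

/-- NOT IN PRINT; OUR BOOKKEEPING ([folklore]; (Q2) AT SECOND ORDER, PACKAGE FORM).  **THE FACE SUM OF THE COMB-CHART CARRIER IN ITS FIRST BOND SLOT IS THE BLOCK SUM OF ITS
WARD WORD**: for ANY sym record and pins, ANY blocking `n`, and ANY residual package of an2's shape (`divW (WcombOf … j) y ν y′ = conjV (dM G′_j S′_j (tabs.M j) ν y′) (X y) + Nr j y ν y′`):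
`faceSum n (μ y ↦ WcombOf … j μ y ν y′) Y = Σ_{v ∈ box} (conjV (dM G′_j S′_j (tabs.M j) ν y′) (X (n•Y+v)) + Nr j (n•Y+v) ν y′)` — commutator words plus the parity-odd residual, block by
block; by road-P2's `CombWardLawParitySplit` (L3) the even half of the carrier carries the commutator words alone, the odd half the residual alone (`faceSum_evenHalf ∕ _oddHalf`). -/
theorem faceSum_firstSlot_WcombOf_of_package (tabs : SymTables d Lc) (cE cVH cΛ cE₂ cB : ℝ) (T : Fin 4 → Fin 4 → Fin 4 → Fin 4 → ℝ)
    {Nr : ℕ → (Fin (d + 1) → ℤ) → Fin (d + 1) → (Fin (d + 1) → ℤ) → MKer (d + 1) (Fib d)}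
    (hlaw : ∀ (j : ℕ) (y : Fin (d + 1) → ℤ) (ν : Fin (d + 1)) (y' : Fin (d + 1) → ℤ),
      divW (WcombOf tabs cE cVH cΛ cE₂ cB T j) y ν y' =
        conjV (dM (GcombSh Lc j) Lc (SpureCombOf tabs cE cVH cΛ j) (tabs.M j) ν y')
          (diagK ((1 / 2 : ℝ) • ∑ v ∈ box (d + 1) Lc, legInd (ctr (d + 1) Lc) ((Lc : ℤ) • y + toSite v))) + Nr j y ν y')
    (j : ℕ) (ν : Fin (d + 1)) (y' : Site (d + 1)) (Y : Site (d + 1)) :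
    faceSum n (fun μ y => WcombOf tabs cE cVH cΛ cE₂ cB T j μ y ν y') Y
      = ∑ v ∈ box (d + 1) n,
          (conjV (dM (GcombSh Lc j) Lc (SpureCombOf tabs cE cVH cΛ j) (tabs.M j) ν y')
              (diagK ((1 / 2 : ℝ) • ∑ w ∈ box (d + 1) Lc, legInd (ctr (d + 1) Lc) ((Lc : ℤ) • ((n : ℤ) • Y + toSite v) + toSite w)))
            + Nr j ((n : ℤ) • Y + toSite v) ν y') := by
  rw [faceSum_firstSlot_eq_sum_box_divW hn]
  exact Finset.sum_congr rfl fun v _ => hlaw j _ ν y'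

end Carrier

end Summit.QuantumFields.BalabanUV.Beta.GAN24.CombSlotTransportFaceWard

end
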